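import Literature.Analysis.FunctionSpaces.TorusSpaceTime
import Literature.Analysis.FunctionSpaces.TorusSpaceTimeFields
import Literature.Analysis.FunctionSpaces.TorusTestFunction
import HarnessLib

/-!
# Bookkeeping for weak formulations on the flat torus: bounds for test fields, integrability
  and splitting of the pairings `∫₀ᵀ ∫ ⟪U, ∂ₜψ⟫`, `∫₀ᵀ ∫ ⟪U, (U·∇)ψ⟫`

Analysis/FunctionSpaces support file (all proved), consumed by the `2½`-dimensional lift of weak
Euler solutions (`Literature/Analysis/FluidPDE/TwoHalfWeakEuler`, Bardos–Titi–Wiedemann 2012,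
proof of Cor. 2). For a field `U : ℝ → T^d → ℝ^d` that is jointly measurable on `(0,T) × T^d`
with slices in `L²` of uniformly bounded norm, and a space–time test field `ψ`
(`Torus.IsSpaceTimeTest T ψ`: smooth space–time lift, compact support in time away from `T`):

* uniform bounds and joint continuity of `ψ`, `∂ₜψ`, `∂ⱼψ` on `K × T^d` for compact `K`
  (`IsSpaceTimeTest.exists_bound*`, `IsSpaceTimeTest.continuous_uncurry*`);
* integrability of `x ↦ ⟪U t x, Φ t x⟫` and of `t ↦ ∫ ⟪U t, Φ t⟫` on `(0,T)` for jointly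
  continuous bounded `Φ` (`integrable_inner_slice`, `integrableOn_integral_inner`), and for the
  convective pairing `⟪U, (U·∇)ψ⟫ = ∑ⱼ Uⱼ ⟪U, ∂ⱼψ⟫` (`inner_convect_eq_sum`,
  `integrable_inner_convect_slice`, `integrableOn_integral_inner_convect`);
* the splitting `∫₀ᵀ∫ (⟪U,∂ₜψ⟫ + ⟪U,(U·∇)ψ⟫ + 0·⟪U,Δψ⟫) = ∫₀ᵀ∫⟪U,∂ₜψ⟫ + ∫₀ᵀ∫⟪U,(U·∇)ψ⟫`
  (`setIntegral_weakIntegrand_eq_add`), the form in which the weak Euler identity of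
  `Torus.IsWeakNSSolutionWithDataOn T 0 u₀ u` is manipulated term by term.

## References

* R. Temam, *Navier–Stokes Equations* (3rd ed., 1984), Ch. III §1.1 (weak formulation).
* C. De Lellis, L. Székelyhidi Jr., Ann. of Math. 170 (2009), §1 (`LellisSzekelyhidi2009`).
* C. Bardos, E. S. Titi, E. Wiedemann, C. R. Math. 350 (2012), proof of Cor. 2
  (`BardosTitiWiedemann2012`).
-/

open MeasureTheory Set Filter Topology UnitAddTorus Function
open scoped ENNReal NNReal InnerProductSpace

noncomputable section

namespace Literature.Analysis.FunctionSpaces.Torus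

variable {d : Type*} [Fintype d] [DecidableEq d]
variable {F : Type*} [NormedAddCommGroup F] [NormedSpace ℝ F]

/-! ## Uniform bounds and joint continuity of space–time test fields -/

section TestBounds

variable {T : ℝ} {ψ : ℝ → UnitAddTorus d → F}

omit [DecidableEq d] in
/-- Space–time test fields are jointly continuous on `ℝ × T^d`. [folklore] -/
theorem IsSpaceTimeTest.continuous_uncurry (hψ : IsSpaceTimeTest T ψ) : Continuous (uncurry ψ) :=
  continuous_uncurry_of_continuous_stLift hψ.1.continuous

omit [DecidableEq d] in
/-- Space–time test fields are bounded on `K × T^d` for compact `K`. [folklore] -/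
theorem IsSpaceTimeTest.exists_bound (hψ : IsSpaceTimeTest T ψ) {K : Set ℝ} (hK : IsCompact K) :
    ∃ C : ℝ, ∀ t ∈ K, ∀ x, ‖ψ t x‖ ≤ C :=
  exists_norm_le_of_continuousOn_of_isCompact (S := univ) hψ.1.continuous.continuousOn hK
    (subset_univ K)

omit [DecidableEq d] in
/-- Time derivatives of space–time test fields are bounded on `K × T^d` for compact `K`. [folklore] -/
theorem IsSpaceTimeTest.exists_bound_timeDeriv (hψ : IsSpaceTimeTest T ψ) {K : Set ℝ}
    (hK : IsCompact K) : ∃ C : ℝ, ∀ t ∈ K, ∀ x, ‖Torus.timeDeriv ψ t x‖ ≤ C :=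
  hψ.timeDeriv.exists_bound hK

omit [DecidableEq d] in
/-- Directional spatial derivatives `(t, x) ↦ ∂ᵥ(ψ t)(x)` of space–time test fields are jointly
continuous (in particular the partial derivatives, `v = eⱼ`). [folklore] -/
theorem IsSpaceTimeTest.continuous_uncurry_lineDeriv (hψ : IsSpaceTimeTest T ψ) (v : EuclideanSpace ℝ d) :
    Continuous (uncurry fun t x => Torus.lineDeriv (ψ t) x v) := by
  have h := ((hψ.isSmoothSpaceTimeOn univ).lineDeriv uniqueDiffOn_univ v).continuousOn_stLift
  rw [univ_prod_univ, continuousOn_univ] at h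
  exact continuous_uncurry_of_continuous_stLift h

/-- Spatial partial derivatives of space–time test fields are bounded on `K × T^d`, `K` compact. [folklore] -/
theorem IsSpaceTimeTest.exists_bound_partialDeriv (hψ : IsSpaceTimeTest T ψ) (j : d) {K : Set ℝ}
    (hK : IsCompact K) : ∃ C : ℝ, ∀ t ∈ K, ∀ x, ‖partialDeriv j (ψ t) x‖ ≤ C :=
  ((hψ.isSmoothSpaceTimeOn univ).partialDeriv uniqueDiffOn_univ j).exists_norm_le_of_isCompact hK
    (subset_univ K)

/-- A common nonnegative bound for all spatial partial derivatives of a space–time test field on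
`K × T^d`, `K` compact. [folklore] -/
theorem IsSpaceTimeTest.exists_bound_sum_partialDeriv (hψ : IsSpaceTimeTest T ψ) {K : Set ℝ}
    (hK : IsCompact K) : ∃ C : ℝ, 0 ≤ C ∧ ∀ t ∈ K, ∀ x, ∑ j, ‖partialDeriv j (ψ t) x‖ ≤ C := by
  choose C hC using fun j => hψ.exists_bound_partialDeriv j hK
  refine ⟨∑ j, |C j|, Finset.sum_nonneg fun j _ => abs_nonneg _, fun t ht x => ?_⟩
  exact Finset.sum_le_sum fun j _ => (hC j t ht x).trans (le_abs_self _)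

end TestBounds

/-! ## Integrability of pairings `t ↦ ∫ ⟪U t, Φ t⟫` -/

section Pairing

variable {G : Type*} [NormedAddCommGroup G] [InnerProductSpace ℝ G]
variable {T : ℝ} {U Φ : ℝ → UnitAddTorus d → G}

omit [DecidableEq d] in
/-- **Slice integrability of the pairing** `x ↦ ⟪U t x, Φ t x⟫` for `U t ∈ L¹` and `Φ` jointly
continuous (bounded slice). [folklore] -/
theorem integrable_inner_slice {t : ℝ} (hU : Integrable (U t) volume) (hΦc : Continuous (uncurry Φ))
    {M : ℝ} (hM : ∀ x, ‖Φ t x‖ ≤ M) : Integrable (fun x => ⟪U t x, Φ t x⟫_ℝ) volume := by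
  have hΦt : Continuous (Φ t) := hΦc.comp (Continuous.prodMk_right t)
  refine (hU.norm.mul_const M).mono' (hU.aestronglyMeasurable.inner hΦt.aestronglyMeasurable)
    (ae_of_all _ fun x => ?_)
  exact (norm_inner_le_norm _ _).trans (mul_le_mul_of_nonneg_left (hM x) (norm_nonneg _))

omit [DecidableEq d] in
/-- **Time integrability of the pairing** `t ↦ ∫ ⟪U t, Φ t⟫` on `(0,T)`: `U` jointly measurable
with slices in `L¹` of uniformly bounded norm, `Φ` jointly continuous and bounded
(`|∫ ⟪U t, Φ t⟫| ≤ M ∫ ‖U t‖ ≤ M C`). [folklore] -/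
theorem integrableOn_integral_inner
    (hUm : AEStronglyMeasurable (uncurry U) ((volume.restrict (Ioo 0 T)).prod (volume : Measure (UnitAddTorus d))))
    (hU : ∀ t ∈ Ioo 0 T, Integrable (U t) volume) {C : ℝ} (hC : ∀ t ∈ Ioo 0 T, ∫ x, ‖U t x‖ ≤ C)
    (hΦc : Continuous (uncurry Φ)) {M : ℝ} (hM : ∀ t ∈ Ioo 0 T, ∀ x, ‖Φ t x‖ ≤ M) (hM0 : 0 ≤ M) :
    IntegrableOn (fun t => ∫ x, ⟪U t x, Φ t x⟫_ℝ) (Ioo 0 T) volume := by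
  have h2 : AEStronglyMeasurable (fun p : ℝ × UnitAddTorus d => ⟪U p.1 p.2, Φ p.1 p.2⟫_ℝ)
      ((volume.restrict (Ioo 0 T)).prod (volume : Measure (UnitAddTorus d))) :=
    hUm.inner hΦc.aestronglyMeasurable
  have hm : AEStronglyMeasurable (fun t => ∫ x, ⟪U t x, Φ t x⟫_ℝ) (volume.restrict (Ioo 0 T)) :=
    h2.integral_prod_right'
  refine IntegrableOn.of_bound measure_Ioo_lt_top hm (M * C) ?_
  rw [ae_restrict_iff' measurableSet_Ioo]
  refine ae_of_all _ fun t ht => ?_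
  calc ‖∫ x, ⟪U t x, Φ t x⟫_ℝ‖ ≤ ∫ x, ‖⟪U t x, Φ t x⟫_ℝ‖ := norm_integral_le_integral_norm _
    _ ≤ ∫ x, M * ‖U t x‖ := by
        refine integral_mono_of_nonneg (ae_of_all _ fun x => norm_nonneg _)
          ((hU t ht).norm.const_mul M) (ae_of_all _ fun x => ?_)
        calc ‖⟪U t x, Φ t x⟫_ℝ‖ ≤ ‖U t x‖ * ‖Φ t x‖ := norm_inner_le_norm _ _
          _ ≤ ‖U t x‖ * M := mul_le_mul_of_nonneg_left (hM t ht x) (norm_nonneg _)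
          _ = M * ‖U t x‖ := mul_comm _ _
    _ = M * ∫ x, ‖U t x‖ := integral_const_mul _ _
    _ ≤ M * C := mul_le_mul_of_nonneg_left (hC t ht) hM0

end Pairing



/-! ## Splitting the weak Euler/Navier–Stokes integrand -/

section WeakSplit

variable {T : ℝ} {U ψ : ℝ → UnitAddTorus d → EuclideanSpace ℝ d}

omit [DecidableEq d] in
/-- `∫ ‖v‖ ≤ 1 + ∫ ‖v‖²` on the probability space `T^d` (`a ≤ 1 + a²`). [folklore] -/
theorem integral_norm_le_one_add_integral_norm_sq {v : UnitAddTorus d → EuclideanSpace ℝ d}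
    (hv : MemLp v 2 volume) : ∫ x, ‖v x‖ ≤ 1 + ∫ x, ‖v x‖ ^ 2 := by
  have h2 : Integrable (fun x => ‖v x‖ ^ 2) volume := hv.integrable_norm_pow two_ne_zero
  have h1 : Integrable (fun x => ‖v x‖) volume := (hv.integrable one_le_two).norm
  calc ∫ x, ‖v x‖ ≤ ∫ x, (1 + ‖v x‖ ^ 2) := by
        refine integral_mono h1 ((integrable_const 1).add h2) fun x => ?_
        nlinarith [sq_nonneg (‖v x‖ - 1), norm_nonneg (v x)]
    _ = 1 + ∫ x, ‖v x‖ ^ 2 := by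
        rw [integral_add (integrable_const 1) h2, integral_const]
        simp

/-- **The convective pairing expanded in partial derivatives**:
`⟪v(x), Dφ(x) v(x)⟫ = ∑ⱼ vⱼ(x) ⟪v(x), ∂ⱼφ(x)⟫` for `C¹` `φ` (Fefferman, eq. (1): `(v·∇)φ = ∑ⱼ vⱼ ∂ⱼφ`). [folklore] -/
theorem inner_convect_eq_sum {v : UnitAddTorus d → EuclideanSpace ℝ d} {φ : UnitAddTorus d → EuclideanSpace ℝ d}
    (hφ : IsContDiff 1 φ) (x : UnitAddTorus d) :
    ⟪v x, convect v φ x⟫_ℝ = ∑ j, v x j * ⟪v x, partialDeriv j φ x⟫_ℝ := by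
  rw [convect, fderiv_apply_eq_sum_partialDeriv hφ, inner_sum]
  refine Finset.sum_congr rfl fun j _ => ?_
  rw [real_inner_smul_right]

/-- Pointwise bound for the expanded convective pairing:
`|∑ⱼ vⱼ ⟪v, ∂ⱼφ⟫| ≤ ‖v‖² ∑ⱼ ‖∂ⱼφ‖`. [folklore] -/
theorem norm_sum_mul_inner_partialDeriv_le {v : UnitAddTorus d → EuclideanSpace ℝ d}
    {φ : UnitAddTorus d → EuclideanSpace ℝ d} (x : UnitAddTorus d) :
    ‖∑ j, v x j * ⟪v x, partialDeriv j φ x⟫_ℝ‖ ≤ ‖v x‖ ^ 2 * ∑ j, ‖partialDeriv j φ x‖ := by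
  rw [Finset.mul_sum]
  refine (norm_sum_le _ _).trans (Finset.sum_le_sum fun j _ => ?_)
  rw [norm_mul, sq]
  calc ‖v x j‖ * ‖⟪v x, partialDeriv j φ x⟫_ℝ‖ ≤ ‖v x‖ * (‖v x‖ * ‖partialDeriv j φ x‖) :=
        mul_le_mul (PiLp.norm_apply_le (v x) j) (norm_inner_le_norm _ _) (norm_nonneg _) (norm_nonneg _)
    _ = ‖v x‖ * ‖v x‖ * ‖partialDeriv j φ x‖ := by ring

/-- **Joint measurability of the expanded convective pairing** on `(0,T) × T^d`. [folklore] -/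
theorem aestronglyMeasurable_sum_mul_inner_partialDeriv
    (hUm : AEStronglyMeasurable (uncurry U) ((volume.restrict (Ioo 0 T)).prod (volume : Measure (UnitAddTorus d))))
    (hψ : IsSpaceTimeTest T ψ) :
    AEStronglyMeasurable (fun p : ℝ × UnitAddTorus d =>
        ∑ j, U p.1 p.2 j * ⟪U p.1 p.2, partialDeriv j (ψ p.1) p.2⟫_ℝ)
      ((volume.restrict (Ioo 0 T)).prod (volume : Measure (UnitAddTorus d))) := by
  refine Finset.aestronglyMeasurable_fun_sum (Finset.univ : Finset d) fun j _ => ?_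
  have h1 : AEStronglyMeasurable (fun p : ℝ × UnitAddTorus d => U p.1 p.2 j)
      ((volume.restrict (Ioo 0 T)).prod (volume : Measure (UnitAddTorus d))) :=
    (EuclideanSpace.proj j).continuous.comp_aestronglyMeasurable hUm
  exact h1.mul (hUm.inner (hψ.continuous_uncurry_lineDeriv (EuclideanSpace.single j 1)).aestronglyMeasurable)

/-- **Slice integrability of the convective pairing** `x ↦ ⟪U t x, (U t·∇)ψ t (x)⟫` for an `L²`
slice and a space–time test field (`|⟪U, (U·∇)ψ⟫| ≤ ‖U‖² ∑ⱼ‖∂ⱼψ‖`). [folklore] -/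
theorem integrable_inner_convect_slice (hψ : IsSpaceTimeTest T ψ) {t : ℝ} (hU : MemLp (U t) 2 volume) :
    Integrable (fun x => ⟪U t x, convect (U t) (ψ t) x⟫_ℝ) volume := by
  obtain ⟨M, hM0, hM⟩ := hψ.exists_bound_sum_partialDeriv (isCompact_singleton (x := t))
  have hC1 : IsContDiff 1 (ψ t) := (hψ.isSmooth_slice t).isContDiff (by simp)
  have heq : (fun x => ⟪U t x, convect (U t) (ψ t) x⟫_ℝ) =
      fun x => ∑ j, U t x j * ⟪U t x, partialDeriv j (ψ t) x⟫_ℝ := funext fun x => inner_convect_eq_sum hC1 x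
  rw [heq]
  have hm : AEStronglyMeasurable (fun x => ∑ j, U t x j * ⟪U t x, partialDeriv j (ψ t) x⟫_ℝ) volume := by
    refine Finset.aestronglyMeasurable_fun_sum (Finset.univ : Finset d) fun j _ => ?_
    exact ((EuclideanSpace.proj j).continuous.comp_aestronglyMeasurable hU.1).mul
      (hU.1.inner ((hψ.isSmooth_slice t).partialDeriv j).continuous.aestronglyMeasurable)
  refine ((hU.integrable_norm_pow two_ne_zero).mul_const M).mono' hm (ae_of_all _ fun x => ?_)
  exact (norm_sum_mul_inner_partialDeriv_le x).trans
    (mul_le_mul_of_nonneg_left (hM t rfl x) (sq_nonneg _))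

/-- **Time integrability of the convective pairing** `t ↦ ∫ ⟪U t, (U t·∇)ψ t⟫` on `(0,T)` under a
uniform `L²` bound on the slices. [folklore] -/
theorem integrableOn_integral_inner_convect
    (hUm : AEStronglyMeasurable (uncurry U) ((volume.restrict (Ioo 0 T)).prod (volume : Measure (UnitAddTorus d))))
    (hU : ∀ t ∈ Ioo 0 T, MemLp (U t) 2 volume) {C : ℝ} (hC : ∀ t ∈ Ioo 0 T, ∫ x, ‖U t x‖ ^ 2 ≤ C)
    (hψ : IsSpaceTimeTest T ψ) :
    IntegrableOn (fun t => ∫ x, ⟪U t x, convect (U t) (ψ t) x⟫_ℝ) (Ioo 0 T) volume := by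
  obtain ⟨M, hM0, hM⟩ := hψ.exists_bound_sum_partialDeriv (isCompact_Icc (a := 0) (b := T))
  have hC1 : ∀ t, IsContDiff 1 (ψ t) := fun t => (hψ.isSmooth_slice t).isContDiff (by simp)
  have heq : (fun t => ∫ x, ⟪U t x, convect (U t) (ψ t) x⟫_ℝ) =
      fun t => ∫ x, ∑ j, U t x j * ⟪U t x, partialDeriv j (ψ t) x⟫_ℝ := by
    funext t
    exact integral_congr_ae (ae_of_all _ fun x => inner_convect_eq_sum (hC1 t) x)
  rw [heq]
  have hm : AEStronglyMeasurable (fun t => ∫ x, ∑ j, U t x j * ⟪U t x, partialDeriv j (ψ t) x⟫_ℝ)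
      (volume.restrict (Ioo 0 T)) :=
    (aestronglyMeasurable_sum_mul_inner_partialDeriv hUm hψ).integral_prod_right'
  refine IntegrableOn.of_bound measure_Ioo_lt_top hm (C * M) ?_
  rw [ae_restrict_iff' measurableSet_Ioo]
  refine ae_of_all _ fun t ht => ?_
  have h2 : Integrable (fun x => ‖U t x‖ ^ 2) volume := (hU t ht).integrable_norm_pow two_ne_zero
  calc ‖∫ x, ∑ j, U t x j * ⟪U t x, partialDeriv j (ψ t) x⟫_ℝ‖
      ≤ ∫ x, ‖∑ j, U t x j * ⟪U t x, partialDeriv j (ψ t) x⟫_ℝ‖ := norm_integral_le_integral_norm _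
    _ ≤ ∫ x, ‖U t x‖ ^ 2 * M := by
        refine integral_mono_of_nonneg (ae_of_all _ fun x => norm_nonneg _) (h2.mul_const M)
          (ae_of_all _ fun x => ?_)
        exact (norm_sum_mul_inner_partialDeriv_le x).trans
          (mul_le_mul_of_nonneg_left (hM t (Ioo_subset_Icc_self ht) x) (sq_nonneg _))
    _ = (∫ x, ‖U t x‖ ^ 2) * M := integral_mul_const _ _
    _ ≤ C * M := mul_le_mul_of_nonneg_right (hC t ht) hM0

omit [DecidableEq d] in
/-- **Slice integrability of the time-derivative pairing** `x ↦ ⟪U t x, ∂ₜψ t x⟫`. [folklore] -/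
theorem integrable_inner_timeDeriv_slice (hψ : IsSpaceTimeTest T ψ) {t : ℝ} (hU : MemLp (U t) 2 volume) :
    Integrable (fun x => ⟪U t x, timeDeriv ψ t x⟫_ℝ) volume := by
  obtain ⟨M, hM⟩ := hψ.exists_bound_timeDeriv (isCompact_singleton (x := t))
  exact integrable_inner_slice (hU.integrable one_le_two) hψ.timeDeriv.continuous_uncurry (hM t rfl)

omit [DecidableEq d] in
/-- **Time integrability of the time-derivative pairing** `t ↦ ∫ ⟪U t, ∂ₜψ t⟫` on `(0,T)`. [folklore] -/
theorem integrableOn_integral_inner_timeDeriv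
    (hUm : AEStronglyMeasurable (uncurry U) ((volume.restrict (Ioo 0 T)).prod (volume : Measure (UnitAddTorus d))))
    (hU : ∀ t ∈ Ioo 0 T, MemLp (U t) 2 volume) {C : ℝ} (hC : ∀ t ∈ Ioo 0 T, ∫ x, ‖U t x‖ ^ 2 ≤ C)
    (hψ : IsSpaceTimeTest T ψ) :
    IntegrableOn (fun t => ∫ x, ⟪U t x, timeDeriv ψ t x⟫_ℝ) (Ioo 0 T) volume := by
  obtain ⟨M, hM⟩ := hψ.exists_bound_timeDeriv (isCompact_Icc (a := 0) (b := T))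
  refine integrableOn_integral_inner hUm (fun t ht => (hU t ht).integrable one_le_two) (C := 1 + C)
    (fun t ht => (integral_norm_le_one_add_integral_norm_sq (hU t ht)).trans (by linarith [hC t ht]))
    hψ.timeDeriv.continuous_uncurry (M := |M|) (fun t ht x => (hM t (Ioo_subset_Icc_self ht) x).trans (le_abs_self M))
    (abs_nonneg M)

/-- **Splitting the weak Euler integrand** (`ν = 0` in `Torus.IsWeakNSSolutionWithDataOn`): under a
uniform `L²` bound on the slices, the space–time integral over `(0,T) × T^d` of
`⟪U, ∂ₜψ⟫ + ⟪U, (U·∇)ψ⟫ + 0·⟪U, Δψ⟫` is the sum of the space–time integrals of `⟪U, ∂ₜψ⟫` and of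
`⟪U, (U·∇)ψ⟫` (Temam, Ch. III §1.1; De Lellis–Székelyhidi 2009, §1). [folklore] -/
theorem setIntegral_weakIntegrand_eq_add
    (hUm : AEStronglyMeasurable (uncurry U) ((volume.restrict (Ioo 0 T)).prod (volume : Measure (UnitAddTorus d))))
    (hU : ∀ t ∈ Ioo 0 T, MemLp (U t) 2 volume) {C : ℝ} (hC : ∀ t ∈ Ioo 0 T, ∫ x, ‖U t x‖ ^ 2 ≤ C)
    (hψ : IsSpaceTimeTest T ψ) :
    (∫ t in Ioo 0 T, ∫ x, (⟪U t x, timeDeriv ψ t x⟫_ℝ + ⟪U t x, convect (U t) (ψ t) x⟫_ℝ +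
        (0 : ℝ) * ⟪U t x, laplacian (ψ t) x⟫_ℝ)) =
      (∫ t in Ioo 0 T, ∫ x, ⟪U t x, timeDeriv ψ t x⟫_ℝ) +
        ∫ t in Ioo 0 T, ∫ x, ⟪U t x, convect (U t) (ψ t) x⟫_ℝ := by
  rw [← integral_add (integrableOn_integral_inner_timeDeriv hUm hU hC hψ)
    (integrableOn_integral_inner_convect hUm hU hC hψ)]
  refine setIntegral_congr_fun measurableSet_Ioo fun t ht => ?_
  rw [← integral_add (integrable_inner_timeDeriv_slice hψ (hU t ht)) (integrable_inner_convect_slice hψ (hU t ht))]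
  refine integral_congr_ae (ae_of_all _ fun x => ?_)
  simp only [zero_mul, add_zero]

end WeakSplit

end Literature.Analysis.FunctionSpaces.Torus

end
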